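import Mathlib.MeasureTheory.Integral.IntervalIntegral.Periodic
import Mathlib.MeasureTheory.Function.Floor
import Mathlib.Analysis.Calculus.Deriv.Shift
import Literature.Probability.RandomPlanarGeometry.WholePlaneSLE
import HarnessLib

/-!
# Scale covariance of whole-plane Loewner chains and of whole-plane SLE_κ(ρ)

Topic `Probability/RandomPlanarGeometry`; sequel to `WholePlaneSLE`, written as a support file for
the self-similarity half of Zhan (2021), Cor. 4.7 (named fact
`IsTwoSidedWholePlaneSLENatLaw.map_dilatePath` of `TwoSidedWholePlaneSLE`, and its corrected form over
measurably uniformized pairs, see `TwoSidedWholePlaneSLEScaling`): the first arm of the two-sided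
whole-plane SLE_κ curve is a whole-plane SLE_κ(2) curve, and the "scaling invariance of
`ν^#_{∞⇌0}`" invoked in Zhan's one-line proof starts with the scale invariance, modulo a shift of
capacity time, of whole-plane SLE_κ(ρ). Everything here is PROVED; no named fact is introduced.

* `WholePlaneLoewnerChain.exists_scaled`: dilating the hulls of a whole-plane Loewner chain by `eˢ`
  and shifting capacity time by `s` gives a whole-plane Loewner chain — hulls `eˢ K_{t-s}`, maps
  `g_{t-s}(e^{-s} z)` — driven by the shifted driving function (any driving angle with the same
  `exp (i·)`); generating curves go along (`IsCurve.exists_scaled`). Lawler (2005), §4.3 (whole-plane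
  capacity: `cap(rK) = cap(K) + log r`) and Prop. 4.21.
* `drivingOfAngle_apply_sub`: for an angle path in `(0, 2π)`, `λ_{t-s}` is again of the form
  `drivingOfAngle q₀' X'` with `X' = X(· - s)` and `q₀' = q₀ + ∫_{-s}^0 cot(X_u/2) du`.
* `map_toIcoMod_add_const_uniformAngleLaw`: shears `q ↦ (q + c) mod 2π` preserve the uniform law on
  `[0, 2π)` (translation invariance of Haar measure on Mathlib's `AddCircle (2π)`).
* `IsWholePlaneSLEKappaRho.exp_mul_comp_sub` / `.const_mul_comp_sub_log`: **whole-plane SLE_κ(ρ)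
  from `0` to `∞` is scale-invariant modulo the capacity time shift** — if `γ` is a whole-plane
  SLE_κ(ρ) curve on `(Ω, P)` then so is `t ↦ c γ(t - log c)` (`c > 0`), on the same space: the
  shifted angle path has the same (stationary) law, and the new phase is uniform and independent of
  it because a shear by a path-measurable amount preserves `law(X) ⊗ uniform`
  (`MeasurePreserving.skew_product`). Miller–Sheffield (2013), §2.1.3 (whole-plane SLE_κ(ρ) is
  driven by the time-stationary solution of Prop. 2.1); Zhan (2021), §3.

## References

* G. F. Lawler, *Conformally Invariant Processes in the Plane*, AMS (2005), §4.3, Prop. 4.21. [Lawler2005]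
* J. Miller, S. Sheffield, *Imaginary geometry IV*, PTRF 169 (2017), §2.1.2–2.1.3, Prop. 2.1. [MillerSheffield2013]
* D. Zhan, *SLE loop measures*, PTRF 179 (2021), arXiv:1702.08026, §3 and Cor. 4.7. [Zhan2021SLELoopMeasures]
-/

noncomputable section

open Set Filter Topology MeasureTheory ProbabilityTheory Complex
open scoped NNReal Real ENNReal

namespace Literature.Probability.RandomPlanarGeometry

open scoped PathBorel

/-! ### Dilating and time-shifting a whole-plane Loewner chain -/

namespace WholePlaneLoewnerChain

variable {lam : ℝ → ℝ}

/-- **Scaling rule for whole-plane Loewner chains.** If `(Kₜ, gₜ)` is the whole-plane Loewner chain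
driven by `exp (i·λₜ)`, then `(eˢ K_{t-s}, z ↦ g_{t-s}(e^{-s} z))` is a whole-plane Loewner chain
(capacity `cap(eˢ K) = cap(K) + s`, same normalisations at `∞` and at `t → -∞`) driven by any angle
`λ₂` with `exp (i·λ₂(t)) = exp (i·λ_{t-s})`. Lawler (2005), §4.3 (scaling of whole-plane capacity)
and Prop. 4.21; Zhan (2021), §3. [cite: Lawler2005, Prop. 4.21] -/
theorem exists_scaled (C : WholePlaneLoewnerChain lam) (s : ℝ) {lam₂ : ℝ → ℝ}
    (h : ∀ t, cexp (lam₂ t * I) = cexp (lam (t - s) * I)) :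
    ∃ C' : WholePlaneLoewnerChain lam₂,
      (∀ t, C'.hull t = (fun z ↦ (Real.exp s : ℂ) * z) '' C.hull (t - s)) ∧
        ∀ t z, C'.map t z = C.map (t - s) ((Real.exp s : ℂ)⁻¹ * z) := by
  set k : ℂ := (Real.exp s : ℂ) with hk_def
  have hk : k ≠ 0 := ofReal_ne_zero.2 (Real.exp_pos s).ne'
  have hbij : Function.Bijective fun z : ℂ ↦ k * z :=
    ⟨mul_right_injective₀ hk, fun w ↦ ⟨k⁻¹ * w, mul_inv_cancel_left₀ hk w⟩⟩
  have hpre : ∀ (A : Set ℂ) (z : ℂ), z ∈ (fun z ↦ k * z) '' A ↔ k⁻¹ * z ∈ A := by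
    intro A z
    constructor
    · rintro ⟨w, hw, rfl⟩
      rwa [inv_mul_cancel_left₀ hk]
    · intro hz
      exact ⟨k⁻¹ * z, hz, mul_inv_cancel_left₀ hk z⟩
  have hsurj : Function.Surjective fun t : ℝ ↦ t - s := fun y ↦ ⟨y + s, add_sub_cancel_right y s⟩
  refine ⟨{ hull := fun t ↦ (fun z ↦ k * z) '' C.hull (t - s)
            map := fun t z ↦ C.map (t - s) (k⁻¹ * z)
            isInteriorHull := ?_
            zero_mem := fun t ↦ ⟨0, C.zero_mem _, mul_zero k⟩
            hull_mono := fun t t' htt' ↦ image_mono (C.hull_mono (sub_le_sub_right htt' s))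
            iInter_hull := ?_
            exists_conformalEquiv := ?_
            capacity := ?_
            hasDerivAt := ?_
            tendsto_atBot := ?_ }, fun t ↦ rfl, fun t z ↦ rfl⟩
  · intro t
    obtain ⟨hc, hconn, hcompl⟩ := C.isInteriorHull (t - s)
    refine ⟨hc.image (continuous_const_mul k), hconn.image _ (continuous_const_mul k).continuousOn, ?_⟩
    rw [← image_compl_eq hbij]
    exact hcompl.image _ (continuous_const_mul k).continuousOn
  · rw [← image_iInter hbij (fun t ↦ C.hull (t - s)), hsurj.iInter_comp (fun t ↦ C.hull t),
      C.iInter_hull, image_singleton, mul_zero]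
  · intro t
    obtain ⟨φ, hφ⟩ := C.exists_conformalEquiv (t - s)
    let ψ : ConformalEquiv ((fun z ↦ k * z) '' C.hull (t - s))ᶜ (C.hull (t - s))ᶜ :=
      { toFun := fun z ↦ k⁻¹ * z
        invFun := fun z ↦ k * z
        source := ((fun z ↦ k * z) '' C.hull (t - s))ᶜ
        target := (C.hull (t - s))ᶜ
        map_source' := fun z hz hz' ↦ hz ((hpre _ z).2 hz')
        map_target' := fun z hz hz' ↦ hz (by rwa [hpre, inv_mul_cancel_left₀ hk] at hz')
        left_inv' := fun z _ ↦ mul_inv_cancel_left₀ hk z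
        right_inv' := fun z _ ↦ inv_mul_cancel_left₀ hk z
        source_eq := rfl
        target_eq := rfl
        differentiableOn := (differentiableOn_id.const_mul k⁻¹)
        differentiableOn_symm := (differentiableOn_id.const_mul k) }
    refine ⟨ψ.trans φ, fun z hz ↦ ?_⟩
    have hz' : k⁻¹ * z ∈ (C.hull (t - s))ᶜ := fun h' ↦ hz ((hpre _ z).2 h')
    change C.map (t - s) (k⁻¹ * z) = φ (k⁻¹ * z)
    exact hφ hz'
  · intro t
    have hψ : Tendsto (fun z : ℂ ↦ k⁻¹ * z) (cocompact ℂ ⊓ 𝓟 ((fun z ↦ k * z) '' C.hull (t - s))ᶜ)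
        (cocompact ℂ ⊓ 𝓟 (C.hull (t - s))ᶜ) := by
      refine (Filter.tendsto_cocompact_mul_left₀ (inv_ne_zero hk)).inf ?_
      rw [tendsto_principal_principal]
      intro z hz hz'
      exact hz ((hpre _ z).2 hz')
    have hlim : k * (Real.exp (t - s) : ℂ) = (Real.exp t : ℂ) := by
      rw [hk_def, ← ofReal_mul, ← Real.exp_add, add_sub_cancel]
    have := ((C.capacity (t - s)).comp hψ).const_mul k
    rw [hlim] at this
    refine this.congr fun z ↦ ?_
    simp only [Function.comp_apply]
    rw [mul_div_assoc', mul_inv_cancel_left₀ hk]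
  · intro t z hz
    have hz' : k⁻¹ * z ∉ C.hull (t - s) := fun h' ↦ hz ((hpre _ z).2 h')
    have hd : HasDerivAt (fun σ ↦ C.map σ (k⁻¹ * z))
        (WholePlaneLoewner.field lam (t - s) (C.map (t - s) (k⁻¹ * z))) (t - s) :=
      C.hasDerivAt (t - s) (k⁻¹ * z) hz'
    have hfield : WholePlaneLoewner.field lam₂ t = WholePlaneLoewner.field lam (t - s) :=
      funext fun w ↦ by rw [WholePlaneLoewner.field_apply, WholePlaneLoewner.field_apply, h t]
    rw [hfield]
    exact hd.comp_sub_const t s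
  · intro z hz
    have hz' : k⁻¹ * z ≠ 0 := mul_ne_zero (inv_ne_zero hk) hz
    have h1 := C.tendsto_atBot (k⁻¹ * z) hz'
    have h2 : Tendsto (fun τ : ℝ ↦ τ - s) atBot atBot :=
      tendsto_atBot_atBot.2 fun b ↦ ⟨b + s, fun a ha ↦ by linarith⟩
    have := (h1.comp h2).const_mul k
    rw [mul_inv_cancel_left₀ hk] at this
    refine this.congr fun τ ↦ ?_
    simp only [Function.comp_apply]
    rw [← mul_assoc, hk_def, ← ofReal_mul, ← Real.exp_add, add_sub_cancel]

/-- **Generating curves scale with the chain**: if the whole-plane Loewner chain driven by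
`exp (i·λ)` is generated by the curve `γ`, then for every `s` the chain driven by (any angle with the
same exponential as) `λ_{· - s}` is generated by `t ↦ eˢ γ(t - s)` — its hulls are `eˢ K_{t-s}` and
filling in commutes with dilations (`Loewner.image_mul_unboundedComponent`). Lawler (2005), §4.3 and
§6.6; Zhan (2021), §3. [cite: Lawler2005, Prop. 4.21] -/
theorem IsCurve.exists_scaled {C : WholePlaneLoewnerChain lam} {γ : ℝ → ℂ} (hγ : C.IsCurve γ)
    (s : ℝ) {lam₂ : ℝ → ℝ} (h : ∀ t, cexp (lam₂ t * I) = cexp (lam (t - s) * I)) :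
    ∃ C' : WholePlaneLoewnerChain lam₂, C'.IsCurve fun t ↦ (Real.exp s : ℂ) * γ (t - s) := by
  obtain ⟨C', hhull, -⟩ := C.exists_scaled s h
  set k : ℂ := (Real.exp s : ℂ) with hk_def
  have hk : k ≠ 0 := ofReal_ne_zero.2 (Real.exp_pos s).ne'
  have hbij : Function.Bijective fun z : ℂ ↦ k * z :=
    ⟨mul_right_injective₀ hk, fun w ↦ ⟨k⁻¹ * w, mul_inv_cancel_left₀ hk w⟩⟩
  obtain ⟨hcont, hlim, hcomp⟩ := hγ
  refine ⟨C', continuous_const.mul (hcont.comp (continuous_id.sub continuous_const)), ?_, fun t ↦ ?_⟩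
  · have h2 : Tendsto (fun τ : ℝ ↦ τ - s) atBot atBot :=
      tendsto_atBot_atBot.2 fun b ↦ ⟨b + s, fun a ha ↦ by linarith⟩
    simpa using (hlim.comp h2).const_mul k
  · have himage : (fun τ ↦ k * γ (τ - s)) '' Iic t = (fun z ↦ k * z) '' (γ '' Iic (t - s)) := by
      ext w
      simp only [mem_image, mem_Iic]
      constructor
      · rintro ⟨τ, hτ, rfl⟩
        exact ⟨γ (τ - s), ⟨τ - s, by linarith, rfl⟩, rfl⟩
      · rintro ⟨_, ⟨u, hu, rfl⟩, rfl⟩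
        exact ⟨u + s, by linarith, by rw [add_sub_cancel_right]⟩
    rw [hhull, ← image_compl_eq hbij, hcomp (t - s), Loewner.image_mul_unboundedComponent hk,
      image_compl_eq hbij, image_insert_eq, mul_zero, himage]

end WholePlaneLoewnerChain

/-! ### The driving angle under a shift of capacity time -/

/-- **Shifting capacity time in the driving angle.** For an angle path `X` living in `(0, 2π)`
(so that `cot(X/2)` is continuous), `λ_{t-s} = q₀ - ∫₀^{t-s} cot(X_u/2) du + X_{t-s}` is again of
the form `drivingOfAngle q₀' X'` with the shifted path `X' = X(· - s)` and the phase
`q₀' = q₀ + ∫₀ˢ cot(X'_w/2) dw = q₀ + ∫_{-s}^0 cot(X_u/2) du` (change of variables and additivity of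
the interval integral). Zhan (2021), §3 (the system `dλ = √κ dB + (ρ/2) cot₂(X) dt`,
`dq = -cot₂(X) dt` is autonomous in `X = λ - q`). [folklore] -/
theorem drivingOfAngle_apply_sub {x : C(ℝ, ℝ)} (hx : ∀ u, x u ∈ Ioo 0 (2 * π)) (q₀ s t : ℝ) :
    drivingOfAngle q₀ x (t - s) =
      drivingOfAngle (q₀ + ∫ w in (0 : ℝ)..s, Real.cot (x (-s + w) / 2)) (timeShift (-s) x) t := by
  have hy : Continuous fun w : ℝ ↦ x (-s + w) / 2 :=
    (x.continuous.comp (continuous_const.add continuous_id)).div_const _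
  have hsin : ∀ w, Real.sin (x (-s + w) / 2) ≠ 0 := fun w ↦
    (Real.sin_pos_of_pos_of_lt_pi (by linarith [(hx (-s + w)).1])
      (by linarith [(hx (-s + w)).2])).ne'
  have hcont : Continuous fun w : ℝ ↦ Real.cot (x (-s + w) / 2) := by
    simp_rw [Real.cot_eq_cos_div_sin]
    exact (Real.continuous_cos.comp hy).div (Real.continuous_sin.comp hy) hsin
  have h1 : ∫ w in s..t, Real.cot (x (-s + w) / 2) = ∫ u in (0 : ℝ)..(t - s), Real.cot (x u / 2) := by
    have := intervalIntegral.integral_comp_add_left (fun u ↦ Real.cot (x u / 2)) (-s) (a := s) (b := t)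
    simpa only [neg_add_cancel, neg_add_eq_sub] using this
  have h2 : ∫ w in s..t, Real.cot (x (-s + w) / 2) =
      (∫ w in (0 : ℝ)..t, Real.cot (x (-s + w) / 2)) - ∫ w in (0 : ℝ)..s, Real.cot (x (-s + w) / 2) :=
    (intervalIntegral.integral_interval_sub_left (hcont.intervalIntegrable 0 t)
      (hcont.intervalIntegrable 0 s)).symm
  simp only [drivingOfAngle, timeShift_apply]
  rw [← h1, h2, neg_add_eq_sub]
  ring

/-- The parametric interval integral `ω ↦ ∫ₐᵇ cot(X_ω(c + w)/2) dw` of a measurable random angle path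
is measurable (measurability of Bochner integrals in a parameter, Mathlib
`StronglyMeasurable.integral_prod_right'`, the integrand being jointly measurable through the
continuous evaluation map on `C(ℝ, ℝ) × ℝ`). [folklore] -/
theorem measurable_intervalIntegral_cot {Ω : Type*} [MeasurableSpace Ω] {X : Ω → C(ℝ, ℝ)}
    (hX : Measurable X) (a b c : ℝ) :
    Measurable fun ω ↦ ∫ w in a..b, Real.cot (X ω (c + w) / 2) := by
  have h1 : Measurable fun p : Ω × ℝ ↦ X p.1 (c + p.2) / 2 := by
    have he : Measurable fun q : C(ℝ, ℝ) × ℝ ↦ q.1 q.2 :=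
      (continuous_eval : Continuous fun q : C(ℝ, ℝ) × ℝ ↦ q.1 q.2).measurable
    exact (he.comp ((hX.comp measurable_fst).prodMk (measurable_snd.const_add c))).div_const 2
  have hf : Measurable fun p : Ω × ℝ ↦ Real.cot (X p.1 (c + p.2) / 2) := by
    simp_rw [Real.cot_eq_cos_div_sin]
    exact (Real.measurable_cos.comp h1).div (Real.measurable_sin.comp h1)
  simp only [intervalIntegral]
  exact (hf.stronglyMeasurable.integral_prod_right' (ν := volume.restrict (Ioc a b))).measurable.sub
    (hf.stronglyMeasurable.integral_prod_right' (ν := volume.restrict (Ioc b a))).measurable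

/-! ### The uniform phase under a shear -/

/-- Reduction modulo `2π` into `[0, 2π)` is measurable (`toIcoMod _ 0 b = fract(b/2π) · 2π`). [folklore] -/
theorem measurable_toIcoMod_two_pi : Measurable (toIcoMod Real.two_pi_pos (0 : ℝ)) := by
  have : toIcoMod Real.two_pi_pos (0 : ℝ) = fun b ↦ Int.fract (b / (2 * π)) * (2 * π) :=
    funext (toIcoMod_eq_fract_mul Real.two_pi_pos)
  rw [this]
  exact (measurable_fract.comp (measurable_id.div_const _)).mul_const _

/-- **Shears preserve the uniform phase**: for every constant `c`, `q ↦ (q + c) mod 2π` maps the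
uniform law on `[0, 2π)` to itself — translation invariance of Haar measure on the circle
`ℝ / 2πℤ` (Mathlib `AddCircle`), read through the measure-preserving covering map
`AddCircle.measurePreserving_mk` and the section `AddCircle.equivIco`. [folklore] -/
theorem map_toIcoMod_add_const_uniformAngleLaw (c : ℝ) :
    uniformAngleLaw.map (fun q ↦ toIcoMod Real.two_pi_pos 0 (q + c)) = uniformAngleLaw := by
  haveI : Fact (0 < 2 * π) := ⟨Real.two_pi_pos⟩
  let mk : ℝ → AddCircle (2 * π) := (↑)
  let e : AddCircle (2 * π) → ℝ := fun x ↦ (AddCircle.equivIco (2 * π) 0 x : ℝ)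
  have hmk : Measurable mk := AddCircle.measurable_mk'
  have he : Measurable e :=
    measurable_subtype_coe.comp (AddCircle.measurableEquivIco (2 * π) 0).measurable
  have he_mk : ∀ q, e (mk q) = toIcoMod Real.two_pi_pos 0 q := fun q ↦ by
    simp [e, mk, AddCircle.equivIco]
  have hadd : Measurable fun x : AddCircle (2 * π) ↦ (c : AddCircle (2 * π)) + x :=
    measurable_const_add _
  have hf : (fun q ↦ toIcoMod Real.two_pi_pos 0 (q + c)) =
      e ∘ (fun x : AddCircle (2 * π) ↦ (c : AddCircle (2 * π)) + x) ∘ mk := by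
    funext q
    simp only [Function.comp_apply, mk]
    rw [← AddCircle.coe_add, he_mk, add_comm]
  let ν : Measure ℝ := volume.restrict (Ioc 0 (0 + 2 * π))
  have hν : (volume : Measure (AddCircle (2 * π))) = ν.map mk :=
    (AddCircle.measurePreserving_mk (2 * π) 0).map_eq.symm
  have hunif : uniformAngleLaw = (ENNReal.ofReal (2 * π))⁻¹ • ν := by
    simp only [uniformAngleLaw, ν, zero_add]
    rw [Measure.restrict_congr_set Ico_ae_eq_Ioc]
  have key : ν.map (fun q ↦ toIcoMod Real.two_pi_pos 0 (q + c)) = ν := by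
    rw [hf, ← Measure.map_map he (hadd.comp hmk), ← Measure.map_map hadd hmk, ← hν,
      (measurePreserving_add_left volume (c : AddCircle (2 * π))).map_eq, hν, Measure.map_map he hmk]
    have hae : (e ∘ mk) =ᵐ[ν] id := by
      have hT : ∀ᵐ x ∂(volume : Measure ℝ), x ∉ ({0 + 2 * π} : Set ℝ) :=
        measure_eq_zero_iff_ae_notMem.1 (measure_singleton _)
      change ∀ᵐ x ∂ν, (e ∘ mk) x = id x
      rw [ae_restrict_iff' measurableSet_Ioc]
      filter_upwards [hT] with x hx hxI
      simp only [Function.comp_apply, id, he_mk]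
      rw [toIcoMod_eq_self]
      exact ⟨hxI.1.le, lt_of_le_of_ne hxI.2 (by simpa using hx)⟩
    rw [Measure.map_congr hae, Measure.map_id]
  rw [hunif, Measure.map_smul, key]

/-! ### Scale covariance of whole-plane SLE_κ(ρ) -/

section SLE

variable {Ω : Type*} [MeasurableSpace Ω] {κ : ℝ≥0} {ρ : ℝ} {P : Measure Ω} {γ : Ω → ℝ → ℂ}

/-- **Whole-plane SLE_κ(ρ) is scale-invariant modulo the capacity time shift** (exponential form):
if `γ` is a whole-plane SLE_κ(ρ) curve from `0` to `∞` on `(Ω, P)`, then so is `t ↦ eˢ γ(t - s)`,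
for every `s ∈ ℝ`, on the same probability space. The rescaled curve generates the rescaled chain
(`WholePlaneLoewnerChain.IsCurve.exists_scaled`), driven by `exp (i λ_{t-s})`; by
`drivingOfAngle_apply_sub` this is the driving function of the shifted angle path `X(· - s)` — whose
law is the same stationary angle law — and of the phase `q₀ + ∫_{-s}^0 cot(X_u/2) du (mod 2π)`, which
is uniform and independent of the shifted path (`map_toIcoMod_add_const_uniformAngleLaw`,
`MeasurePreserving.skew_product`). Miller–Sheffield (2013), §2.1.3 (whole-plane SLE_κ(ρ) is driven
by the time-stationary solution, Prop. 2.1); Zhan (2021), §3. [cite: MillerSheffield2013, §2.1.3] -/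
theorem IsWholePlaneSLEKappaRho.exp_mul_comp_sub (h : IsWholePlaneSLEKappaRho κ ρ P γ) (s : ℝ) :
    IsWholePlaneSLEKappaRho κ ρ P (fun ω t ↦ (Real.exp s : ℂ) * γ ω (t - s)) := by
  obtain ⟨hmeas, X, q₀, hX, hq₀, hlaw, hunif, hind, hae⟩ := h
  haveI hPX := hlaw.isProbabilityMeasure
  haveI : IsProbabilityMeasure P :=
    ⟨by simpa [Measure.map_apply hX MeasurableSet.univ] using (measure_univ : (P.map X) univ = 1)⟩
  -- the new angle path, the shear, the new phase
  let X' : Ω → C(ℝ, ℝ) := fun ω ↦ timeShift (-s) (X ω)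
  let F : C(ℝ, ℝ) → ℝ := fun x ↦ ∫ w in (0 : ℝ)..s, Real.cot (x (-s + w) / 2)
  let q₀' : Ω → ℝ := fun ω ↦ toIcoMod Real.two_pi_pos 0 (q₀ ω + F (X ω))
  have hX' : Measurable X' := (measurable_timeShift _).comp hX
  have hF : Measurable F := measurable_intervalIntegral_cot (X := id) measurable_id 0 s (-s)
  have hq₀' : Measurable q₀' := measurable_toIcoMod_two_pi.comp (hq₀.add (hF.comp hX))
  -- laws
  have hlawX' : P.map X' = P.map X := by
    have : X' = timeShift (-s) ∘ X := rfl
    rw [this, ← Measure.map_map (measurable_timeShift _) hX, hlaw.map_timeShift]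
  have hjoint : P.map (fun ω ↦ (X' ω, q₀' ω)) = (P.map X).prod uniformAngleLaw := by
    have h1 : P.map (fun ω ↦ (X ω, q₀ ω)) = (P.map X).prod uniformAngleLaw := by
      rw [← hunif]
      exact (indepFun_iff_map_prod_eq_prod_map_map hX.aemeasurable hq₀.aemeasurable).1 hind
    let T : C(ℝ, ℝ) × ℝ → C(ℝ, ℝ) × ℝ :=
      fun p ↦ (timeShift (-s) p.1, toIcoMod Real.two_pi_pos 0 (p.2 + F p.1))
    have hT : MeasurePreserving T ((P.map X).prod uniformAngleLaw) ((P.map X).prod uniformAngleLaw) :=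
      MeasurePreserving.skew_product (f := timeShift (-s))
        (g := fun x q ↦ toIcoMod Real.two_pi_pos 0 (q + F x))
        ⟨measurable_timeShift _, hlaw.map_timeShift _⟩
        (measurable_toIcoMod_two_pi.comp (measurable_snd.add (hF.comp measurable_fst)))
        (ae_of_all _ fun x ↦ map_toIcoMod_add_const_uniformAngleLaw (F x))
    have hcomp : (fun ω ↦ (X' ω, q₀' ω)) = T ∘ fun ω ↦ (X ω, q₀ ω) := rfl
    rw [hcomp, ← Measure.map_map hT.measurable (hX.prodMk hq₀), h1, hT.map_eq]
  have hlawq : P.map q₀' = uniformAngleLaw := by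
    have := congrArg Measure.snd hjoint
    rwa [Measure.snd_map_prodMk hX', Measure.snd_prod] at this
  have hind' : IndepFun X' q₀' P := by
    rw [indepFun_iff_map_prod_eq_prod_map_map hX'.aemeasurable hq₀'.aemeasurable, hjoint, hlawX',
      hlawq]
  refine ⟨fun t ↦ (hmeas (t - s)).const_mul _, X', q₀', hX', hq₀', by rwa [hlawX'], hlawq, hind', ?_⟩
  -- the chain, almost surely
  have hIoo : ∀ᵐ ω ∂P, ∀ u, X ω u ∈ Ioo 0 (2 * π) := ae_of_ae_map hX.aemeasurable hlaw.2.1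
  filter_upwards [hae, hIoo] with ω hω hωI
  obtain ⟨C, hC⟩ := hω
  refine hC.exists_scaled s fun t ↦ ?_
  have hd : ∀ (q m : ℝ) (y : C(ℝ, ℝ)) (τ : ℝ),
      drivingOfAngle (q - m) y τ = drivingOfAngle q y τ - m := fun q m y τ ↦ by
    simp only [drivingOfAngle]
    ring
  have hq : q₀' ω = q₀ ω + F (X ω) -
      (toIcoDiv Real.two_pi_pos 0 (q₀ ω + F (X ω)) : ℝ) * (2 * π) := by
    simp only [q₀']
    rw [← self_sub_toIcoDiv_zsmul, zsmul_eq_mul]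
  rw [drivingOfAngle_apply_sub hωI (q₀ ω) s t, hq, hd]
  push_cast
  rw [sub_mul, Complex.exp_sub, mul_assoc, mul_assoc,
    ← show (2 * (π : ℂ) * I) = 2 * ((π : ℂ) * I) by ring,
    Complex.exp_int_mul_two_pi_mul_I, div_one]

/-- **Whole-plane SLE_κ(ρ) is scale-invariant modulo the capacity time shift**: if `γ` is a
whole-plane SLE_κ(ρ) curve from `0` to `∞` on `(Ω, P)` (capacity parametrisation) then so is
`t ↦ c γ(t - log c)` for every `c > 0` (the dilate `c K` of a hull of whole-plane capacity `t` has
capacity `t + log c`). Miller–Sheffield (2013), §2.1.3; Zhan (2021), §3; Lawler (2005), §4.3.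
[cite: MillerSheffield2013, §2.1.3] -/
theorem IsWholePlaneSLEKappaRho.const_mul_comp_sub_log (h : IsWholePlaneSLEKappaRho κ ρ P γ)
    {c : ℝ} (hc : 0 < c) :
    IsWholePlaneSLEKappaRho κ ρ P (fun ω t ↦ (c : ℂ) * γ ω (t - Real.log c)) := by
  simpa [Real.exp_log hc] using h.exp_mul_comp_sub (Real.log c)

end SLE

end Literature.Probability.RandomPlanarGeometry
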